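import Literature.Analysis.OperatorTheory.YangMillsMatrixModelCutoffEnergy
import HarnessLib

/-!
# A smooth radial cut-off `χ_R` on `ℝ⁹` for the quasimode construction (Helffer 1988 (4.2.8)′), with bounds

Topic `Literature/Analysis/OperatorTheory`, companion of `YangMillsMatrixModelCutoffEnergy.lean` (§5–§6 there are
stated for an arbitrary `C²_c` cut-off `χ` with `χ = 1` on the ball `‖x‖ < R`, `|1 − χ²| ≤ M`, `‖∇χ‖² ≤ M'`).
This file supplies such a cut-off explicitly, in the tree's vocabulary (`ZM = ℝ⁹`, `IsTestFn`, `IsGaugeInv`,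
`pderiv`, `gradient`), so that the quasimode space of cut-off eigenfunctions can be written down without further
choices:

Source: B. Helffer, *Semi-classical analysis for the Schrödinger operator and applications*, LNM 1336 (1988),
§4.2, (4.2.8)′–(4.2.9): the quasimodes `Ψ_{j,k} = χ_j φ_{j,k}` with `χ_S^j` *"with support in B(U_j, S) and equal
to 1 in B(U_j, S − η)"*; and Mathlib's `Real.smoothTransition` (a `C^∞` monotone step, `= 0` on `(−∞,0]`, `= 1` on
`[1,∞)`) as the profile.  [cite: Agmon1982, (1.16)] for the rôle of Lipschitz/smooth cut-offs in the energy identities.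

* `cutoffProfile t = smoothTransition (2 − t)` — `= 1` for `t ≤ 1`, `= 0` for `t ≥ 2`, values in `[0,1]`, `C^∞`;
* `radialCutoffOne x = cutoffProfile (‖x‖²)` and the scaled **`radialCutoff R x = radialCutoffOne (R⁻¹ • x)`**
  (`= cutoffProfile (‖x‖²/R²)`): `C^∞`, `= 1` on `‖x‖ ≤ R`, `= 0` for `‖x‖² ≥ 2R²`, `0 ≤ χ_R ≤ 1`, `|1 − χ_R²| ≤ 1`,
  compact support, `IsTestFn`, colour-rotation invariant (`IsGaugeInv`, radial), and the gradient bound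
  `‖∇χ_R(x)‖² = R⁻² ‖∇χ₁(R⁻¹x)‖² ≤ M₁/R²` with `M₁ = sup ‖∇χ₁‖²` (`exists_gradBound_one`, `norm_gradient_sq_radialCutoff_le`).

Definitions + proved lemmas only; no named facts, 0 sorry.
-/

noncomputable section

open MeasureTheory Filter Topology Function
open scoped BigOperators

namespace Literature.Analysis.OperatorTheory.YMMatrixModel

/-! ### 1. The profile -/

/-- The cut-off profile `ρ(t) = smoothTransition(2 − t)`: smooth, `= 1` for `t ≤ 1`, `= 0` for `t ≥ 2`, values in
`[0,1]`. [cite: Agmon1982, (1.16)] -/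
def cutoffProfile (t : ℝ) : ℝ := Real.smoothTransition (2 - t)

/-- `ρ` is smooth. [cite: Agmon1982, (1.16)] -/
theorem cutoffProfile_contDiff {n : ℕ∞} : ContDiff ℝ n cutoffProfile :=
  Real.smoothTransition.contDiff.comp (contDiff_const.sub contDiff_id)

/-- `ρ(t) = 1` for `t ≤ 1`. [cite: Agmon1982, (1.16)] -/
theorem cutoffProfile_eq_one {t : ℝ} (ht : t ≤ 1) : cutoffProfile t = 1 :=
  Real.smoothTransition.one_of_one_le (by linarith)

/-- `ρ(t) = 0` for `t ≥ 2`. [cite: Agmon1982, (1.16)] -/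
theorem cutoffProfile_eq_zero {t : ℝ} (ht : 2 ≤ t) : cutoffProfile t = 0 :=
  Real.smoothTransition.zero_of_nonpos (by linarith)

/-- `0 ≤ ρ ≤ 1`. [cite: Agmon1982, (1.16)] -/
theorem cutoffProfile_mem_Icc (t : ℝ) : cutoffProfile t ∈ Set.Icc (0 : ℝ) 1 :=
  ⟨Real.smoothTransition.nonneg _, Real.smoothTransition.le_one _⟩

/-! ### 2. The unit radial cut-off `χ₁(x) = ρ(‖x‖²)` -/

/-- `χ₁(x) = ρ(‖x‖²)`: equal to `1` on the closed unit ball, vanishing for `‖x‖² ≥ 2`. [cite: Agmon1982, (1.16)] -/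
def radialCutoffOne (x : ZM) : ℝ := cutoffProfile (‖x‖ ^ 2)

/-- `χ₁` is smooth. [cite: Agmon1982, (1.16)] -/
theorem radialCutoffOne_contDiff {n : ℕ∞} : ContDiff ℝ n radialCutoffOne :=
  cutoffProfile_contDiff.comp (contDiff_norm_sq ℝ)

/-- `χ₁ = 1` on `‖x‖ ≤ 1`. [cite: Agmon1982, (1.16)] -/
theorem radialCutoffOne_eq_one {x : ZM} (hx : ‖x‖ ≤ 1) : radialCutoffOne x = 1 :=
  cutoffProfile_eq_one (by nlinarith [norm_nonneg x])

/-- `χ₁ = 0` for `‖x‖² ≥ 2`. [cite: Agmon1982, (1.16)] -/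
theorem radialCutoffOne_eq_zero {x : ZM} (hx : 2 ≤ ‖x‖ ^ 2) : radialCutoffOne x = 0 :=
  cutoffProfile_eq_zero hx

/-- `0 ≤ χ₁ ≤ 1`. [cite: Agmon1982, (1.16)] -/
theorem radialCutoffOne_mem_Icc (x : ZM) : radialCutoffOne x ∈ Set.Icc (0 : ℝ) 1 := cutoffProfile_mem_Icc _

/-- `χ₁` has compact support (inside the closed ball of radius `2`). [cite: Agmon1982, (1.16)] -/
theorem radialCutoffOne_hasCompactSupport : HasCompactSupport radialCutoffOne := by
  refine HasCompactSupport.intro (isCompact_closedBall (0 : ZM) 2) fun x hx => ?_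
  rw [Metric.mem_closedBall, dist_zero_right, not_le] at hx
  exact radialCutoffOne_eq_zero (by nlinarith [norm_nonneg x])

/-- `χ₁ ∈ C²_c`. [cite: Agmon1982, (1.16)] -/
theorem isTestFn_radialCutoffOne : IsTestFn radialCutoffOne :=
  ⟨by have h := radialCutoffOne_contDiff (n := 2); exact_mod_cast h, radialCutoffOne_hasCompactSupport⟩

/-- `χ₁` is colour-rotation invariant (it is radial and colour rotations are isometries). [cite: Vanbaal2001, §4] -/
theorem isGaugeInv_radialCutoffOne : IsGaugeInv radialCutoffOne := fun R hR x => by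
  unfold radialCutoffOne
  rw [norm_colourRotate hR]

/-- **Uniform gradient bound for `χ₁`**: `M₁ := sup_x ‖∇χ₁(x)‖² < ∞` (a continuous compactly supported function
attains its maximum). [cite: Agmon1982, (1.16)] -/
theorem exists_gradBound_one : ∃ M₁ : ℝ, 0 ≤ M₁ ∧ ∀ x : ZM, ‖gradient radialCutoffOne x‖ ^ 2 ≤ M₁ := by
  have hχ := isTestFn_radialCutoffOne
  set g : ZM → ℝ := fun x => ∑ p, (pderiv p radialCutoffOne x) ^ 2 with hg
  have hgc : Continuous g := continuous_finsetSum _ fun p _ => (hχ.continuous_pderiv p).pow 2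
  have hgs : HasCompactSupport g :=
    HasCompactSupport.intro hχ.2 fun x hx => by simp [hg, pderiv_eq_zero_of_notMem_tsupport hx]
  obtain ⟨x₀, hx₀⟩ := hgc.exists_forall_ge_of_hasCompactSupport hgs
  refine ⟨g x₀, Finset.sum_nonneg fun p _ => sq_nonneg _, fun x => ?_⟩
  rw [norm_gradient_sq]
  exact hx₀ x

/-! ### 3. The scaled cut-off `χ_R(x) = χ₁(x/R)` -/

/-- **The radial cut-off at scale `R`**: `χ_R(x) = χ₁(R⁻¹ x) = ρ(‖x‖²/R²)` — equal to `1` on `‖x‖ ≤ R`, vanishing for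
`‖x‖² ≥ 2R²`. [cite: Agmon1982, (1.16)] -/
def radialCutoff (R : ℝ) (x : ZM) : ℝ := radialCutoffOne (R⁻¹ • x)

/-- `χ_R` is smooth. [cite: Agmon1982, (1.16)] -/
theorem radialCutoff_contDiff (R : ℝ) {n : ℕ∞} : ContDiff ℝ n (radialCutoff R) :=
  radialCutoffOne_contDiff.comp (contDiff_id.const_smul R⁻¹)

/-- The norm of the rescaled point: `‖R⁻¹ x‖ = ‖x‖ / R` (`R > 0`). [cite: Agmon1982, (1.16)] -/
theorem norm_inv_smul {R : ℝ} (hR : 0 < R) (x : ZM) : ‖R⁻¹ • x‖ = ‖x‖ / R := by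
  rw [norm_smul, Real.norm_eq_abs, abs_of_pos (inv_pos.mpr hR), inv_mul_eq_div]

/-- `χ_R = 1` on the closed ball `‖x‖ ≤ R` (`R > 0`). [cite: Agmon1982, (1.16)] -/
theorem radialCutoff_eq_one {R : ℝ} (hR : 0 < R) {x : ZM} (hx : ‖x‖ ≤ R) : radialCutoff R x = 1 := by
  unfold radialCutoff
  refine radialCutoffOne_eq_one ?_
  rw [norm_inv_smul hR, div_le_one hR]
  exact hx

/-- In particular `χ_R = 1` on the open ball `‖x‖ < R`. [cite: Agmon1982, (1.16)] -/
theorem radialCutoff_eq_one_of_lt {R : ℝ} (hR : 0 < R) {x : ZM} (hx : ‖x‖ < R) : radialCutoff R x = 1 :=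
  radialCutoff_eq_one hR hx.le

/-- `χ_R = 0` for `‖x‖² ≥ 2R²` (`R > 0`). [cite: Agmon1982, (1.16)] -/
theorem radialCutoff_eq_zero {R : ℝ} (hR : 0 < R) {x : ZM} (hx : 2 * R ^ 2 ≤ ‖x‖ ^ 2) : radialCutoff R x = 0 := by
  unfold radialCutoff
  refine radialCutoffOne_eq_zero ?_
  rw [norm_inv_smul hR, div_pow, le_div_iff₀ (pow_pos hR 2)]
  exact hx

/-- `0 ≤ χ_R ≤ 1`. [cite: Agmon1982, (1.16)] -/
theorem radialCutoff_mem_Icc (R : ℝ) (x : ZM) : radialCutoff R x ∈ Set.Icc (0 : ℝ) 1 :=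
  radialCutoffOne_mem_Icc _

/-- `|1 − χ_R²| ≤ 1` (the mass-tail weight of `YangMillsMatrixModelCutoffEnergy` §6 with `M = 1`). [cite: Agmon1982, (1.16)] -/
theorem abs_one_sub_radialCutoff_sq_le (R : ℝ) (x : ZM) : |1 - radialCutoff R x ^ 2| ≤ 1 := by
  obtain ⟨h0, h1⟩ := radialCutoff_mem_Icc R x
  rw [abs_le]
  constructor <;> nlinarith

/-- `χ_R` has compact support (`R > 0`; inside the closed ball of radius `2R`). [cite: Agmon1982, (1.16)] -/
theorem radialCutoff_hasCompactSupport {R : ℝ} (hR : 0 < R) : HasCompactSupport (radialCutoff R) := by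
  refine HasCompactSupport.intro (isCompact_closedBall (0 : ZM) (2 * R)) fun x hx => ?_
  rw [Metric.mem_closedBall, dist_zero_right, not_le] at hx
  exact radialCutoff_eq_zero hR (by nlinarith [norm_nonneg x])

/-- `χ_R ∈ C²_c` (`R > 0`). [cite: Agmon1982, (1.16)] -/
theorem isTestFn_radialCutoff {R : ℝ} (hR : 0 < R) : IsTestFn (radialCutoff R) :=
  ⟨by have h := radialCutoff_contDiff R (n := 2); exact_mod_cast h, radialCutoff_hasCompactSupport hR⟩

/-- Colour rotations commute with the rescaling `x ↦ R⁻¹ x`. [cite: Vanbaal2001, §4] -/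
theorem colourRotate_smul (M : Matrix (Fin 3) (Fin 3) ℝ) (c : ℝ) (x : ZM) :
    colourRotate M (c • x) = c • colourRotate M x := by
  ext p
  simp [colourRotate, Finset.mul_sum, mul_left_comm]

/-- `χ_R` is colour-rotation invariant. [cite: Vanbaal2001, §4] -/
theorem isGaugeInv_radialCutoff (R : ℝ) : IsGaugeInv (radialCutoff R) := fun M hM x => by
  unfold radialCutoff
  rw [← colourRotate_smul]
  exact isGaugeInv_radialCutoffOne M hM _

/-- Chain rule under rescaling: `∂_p χ_R(x) = R⁻¹ (∂_p χ₁)(R⁻¹ x)`. [cite: Agmon1982, (1.16)] -/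
theorem pderiv_radialCutoff (R : ℝ) (p : Fin 3 × Fin 3) (x : ZM) :
    pderiv p (radialCutoff R) x = R⁻¹ * pderiv p radialCutoffOne (R⁻¹ • x) := by
  have hd : DifferentiableAt ℝ radialCutoffOne (R⁻¹ • x) :=
    (radialCutoffOne_contDiff (n := 1)).differentiable (by norm_num) _
  have hs : HasFDerivAt (fun y : ZM => R⁻¹ • y) (R⁻¹ • ContinuousLinearMap.id ℝ ZM) x :=
    (hasFDerivAt_id x).const_smul R⁻¹
  have hc : HasFDerivAt (radialCutoff R)
      ((fderiv ℝ radialCutoffOne (R⁻¹ • x)).comp (R⁻¹ • ContinuousLinearMap.id ℝ ZM)) x :=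
    hd.hasFDerivAt.comp x hs
  rw [pderiv, hc.fderiv, pderiv]
  simp [smul_eq_mul]

/-- **Gradient bound for `χ_R`**: `‖∇χ_R(x)‖² = R⁻² ‖∇χ₁(R⁻¹x)‖² ≤ M₁ / R²`, with `M₁` the bound of
`exists_gradBound_one`. [cite: Agmon1982, (1.16)] -/
theorem norm_gradient_sq_radialCutoff_le {M₁ : ℝ} (hM₁ : ∀ y : ZM, ‖gradient radialCutoffOne y‖ ^ 2 ≤ M₁)
    (R : ℝ) (x : ZM) : ‖gradient (radialCutoff R) x‖ ^ 2 ≤ M₁ / R ^ 2 := by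
  have e : ‖gradient (radialCutoff R) x‖ ^ 2 = (R ^ 2)⁻¹ * ‖gradient radialCutoffOne (R⁻¹ • x)‖ ^ 2 := by
    rw [norm_gradient_sq, norm_gradient_sq, Finset.mul_sum]
    refine Finset.sum_congr rfl fun p _ => ?_
    rw [pderiv_radialCutoff, mul_pow, inv_pow]
  rw [e, div_eq_mul_inv, mul_comm]
  by_cases hR : R = 0
  · subst hR; simp
  · exact mul_le_mul_of_nonneg_right (hM₁ _) (inv_nonneg.mpr (sq_nonneg R))

/-- **The radial cut-off package** used by the quasimode construction: for every `R ≥ 1` there is ONE constant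
`M₁` (independent of `R`) with `‖∇χ_R‖² ≤ M₁`, and `χ_R ∈ C²_c` is colour-invariant, equal to `1` on `‖x‖ < R`, with
`0 ≤ χ_R ≤ 1` and `|1 − χ_R²| ≤ 1` — exactly the hypotheses of `abs_tail_le` / `abs_gradTail_le` and of
`energyForm_span_le_physLevel`. [cite: Agmon1982, (1.16)] -/
theorem radialCutoff_package : ∃ M₁ : ℝ, 0 ≤ M₁ ∧ ∀ R : ℝ, 1 ≤ R →
    IsTestFn (radialCutoff R) ∧ IsGaugeInv (radialCutoff R) ∧
    (∀ x : ZM, ‖x‖ < R → radialCutoff R x = 1) ∧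
    (∀ x : ZM, |1 - radialCutoff R x ^ 2| ≤ 1) ∧
    (∀ x : ZM, ‖gradient (radialCutoff R) x‖ ^ 2 ≤ M₁) := by
  obtain ⟨M₁, hM0, hM⟩ := exists_gradBound_one
  refine ⟨M₁, hM0, fun R hR => ?_⟩
  have hR0 : 0 < R := lt_of_lt_of_le one_pos hR
  refine ⟨isTestFn_radialCutoff hR0, isGaugeInv_radialCutoff R, fun x hx => radialCutoff_eq_one_of_lt hR0 hx,
    abs_one_sub_radialCutoff_sq_le R, fun x => (norm_gradient_sq_radialCutoff_le hM R x).trans ?_⟩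
  rw [div_le_iff₀ (pow_pos hR0 2)]
  nlinarith [one_le_pow₀ (n := 2) hR]

end Literature.Analysis.OperatorTheory.YMMatrixModel

end
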